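import Summits.CriticalPhenomena.PercolationContinuityZ3.Theorems.Transplant.FKConnectivityAllQAntipodalLevel4
import HarnessLib

/-!
# Connectivity correlation inequalities for `φ_{w,q}`, every `q > 0` — file 36: **ONE-SUMS** — the antipodal form of a graph glued
# to another at one vertex FOLDS onto the block carrying `f`; `C_∞`-type inequalities pass to one-sums; U¹¹ with the split pair
# separated by a cut vertex

Support file (`--supports stmt-CriticalPhenomena-4575`), FK sub-lane `prim-bschramm-fk-2` (gen 20); builds on p205010 (kernel theorem,
internal audit signed; external expert review pending).  No definitions, no named facts, no sorries; standard axioms.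

WHY.  Gen 10's Conjecture `C_∞` is about EVERY coefficient of `Z_H² Cov_{φ_{z,q}}(f,g)`; the coefficient of `z^{2·1_C + 1_M}` is the antipodal
form of the MINOR `H / C ∖ D` (`…AntipodalMinorDefs`).  Deleting edges from a 2-connected series–parallel graph leaves a ONE-SUM of blocks (and,
by the planar self-duality of the antipodal weight, memo g15 §12.1, contracting is deleting in the dual).  So the cells of `C_∞` live on
one-sums, and this file supplies the transfer: if the parts `M₁ ⊆ E₁`, `M₂ ⊆ E₂` of `M = M₁ ⊔ M₂` have vertex supports meeting in at most
one vertex `m`, then `k(γ) + k(M∖γ) + 2|V| = (k(γ₁)+k(M₁∖γ₁)) + (k(γ₂)+k(M₂∖γ₂))` (`FK.apExp_series`, gen 11) and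
* **`FK.apPsi_oneSum_eq`** (THE FOLD): for `f` not reading `M₂`,
  `q^{2|V|} · apPsi q (M₁ ⊔ M₂) f g = apPsi q M₁ f ĝ`, `ĝ(β) := Σ_{γ₂ ⊆ M₂} q^{k(γ₂)+k(M₂∖γ₂)} g(β ∪ γ₂)`
  (the symmetry `γ₂ ↦ M₂ ∖ γ₂` of the second factor folds `g(M∖γ)` onto `ĝ(M₁∖γ₁)`); `ĝ` is monotone when `g` is and reads only what `g`
  reads inside `M₁` (`FK.oneSumFold_insert`, `FK.oneSumFold_mono`);
* **`FK.apPsi_oneSum_nonpos_of`**: hence ANY inequality `apPsi q M₁ f h ≤ 0 ∀ h monotone not reading S` transfers verbatim to `M₁ ⊔ M₂`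
  (no hypothesis at all on `M₂`: `C_∞`-type statements are stable under gluing arbitrary finite graphs at cut vertices of the `f`-block);
* `FK.apPsi_pivot_eq_two_mul` (`apPsi q M 1_z g' = 2 Σ_γ q^{k+k̄}(1_z(γ) − 1_z(M∖γ)) g'(γ)`);
* **`FK.apPsi_pivot_split_oneSum_nonpos`** — U¹¹ WITH THE SPLIT PAIR SEPARATED BY THE CUT VERTEX: pivot `x` and `y` in the 2-connected
  series–parallel block `M₁ = E ∪ {st}`, `z ∈ M₂`, `M₂` any part on which Theorem U holds at `z` ⟹ `apPsi q (M₁ ⊔ M₂) 1_x (split_{yz}·g) ≤ 0`.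
  Proof: the fold is `ĝ(β) = 1{y∈β}·G_out(β) + 1{y∉β}·G_in(β)` with `G_in/out(β) = Σ_{γ₂ ∋ z / ∌ z} q^{k+k̄} g(β∪γ₂)`; it is MONOTONE because
  `G_in ≤ G_out` pointwise, which is Theorem U on `M₂` at `z` against `g(β ∪ ·)`; then Theorem U on `M₁` at `x` (`FK.apPsi_pivot_nonpos_of_isTTSP`);
* `FK.apPsi_pivot_split_oneSum_nonpos'` — both marked edges in `M₂`: the fold is monotone outright.
With gen 16's U¹¹ and `FK.apPsi_oneSum_nonpos_of` (all three of `x, y, z` in `M₁`) this is U¹¹ on every one-sum `M₁ ⊔ M₂` of a 2-connected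
series–parallel graph with a graph satisfying Theorem U — the deletion-cell half of 'U¹¹ in every cell' (memo `bschramm/FROM-fk-2-g20-*.md` §2;
census: 0 violations in all `3^{|N|}` cells of all 2-connected SP hosts with ≤ 7 edges, 1.1·10⁶ exact evaluations).
[cite: Grimmett2006, §1.4 eq. (1.20) (p. 15); §3.8 Thm. (3.90) (pp. 61–62); §3.9 (pp. 63–64)] [cite: Wagner2006, Thm. 5.8(d), §5.3]
-/

noncomputable section

namespace Summit.CriticalPhenomena.PercolationContinuityZ3.Theorems

namespace FK

open Literature.Probability.LatticeModels Literature.Probability.Percolation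
open scoped Classical

variable {V : Type*} [Fintype V]

section OneSum

variable {E₁ E₂ : Finset (Sym2 V)} {V₁ V₂ : Set V} {m : V}

/-! ### The fold -/

omit [Fintype V] in
/-- The folded test function `ĝ(β) = Σ_{γ₂ ⊆ M₂} q^{k(γ₂)+k(M₂∖γ₂)} g(β ∪ γ₂)` does not read an edge that `g` does not read. [folklore] -/
theorem oneSumFold_insert (q : ℝ) (M₂ : Finset (Sym2 V)) {g : Finset (Sym2 V) → ℝ} {e : Sym2 V}
    (hg : ∀ A : Finset (Sym2 V), g (insert e A) = g A) (A : Finset (Sym2 V)) :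
    (∑ γ₂ ∈ M₂.powerset, q ^ apExp M₂ γ₂ * g (insert e A ∪ γ₂)) = ∑ γ₂ ∈ M₂.powerset, q ^ apExp M₂ γ₂ * g (A ∪ γ₂) :=
  Finset.sum_congr rfl fun γ₂ _ => by rw [Finset.insert_union, hg]

omit [Fintype V] in
/-- The folded test function is monotone on the subsets of `M₁` when `g` is monotone on the subsets of `M₁ ∪ M₂` (`q ≥ 0`). [folklore] -/
theorem oneSumFold_mono {q : ℝ} (hq : 0 ≤ q) {M₁ M₂ : Finset (Sym2 V)} {g : Finset (Sym2 V) → ℝ}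
    (hmono : ∀ ⦃A B : Finset (Sym2 V)⦄, A ⊆ B → B ⊆ M₁ ∪ M₂ → g A ≤ g B) ⦃A B : Finset (Sym2 V)⦄ (hAB : A ⊆ B) (hB : B ⊆ M₁) :
    (∑ γ₂ ∈ M₂.powerset, q ^ apExp M₂ γ₂ * g (A ∪ γ₂)) ≤ ∑ γ₂ ∈ M₂.powerset, q ^ apExp M₂ γ₂ * g (B ∪ γ₂) :=
  Finset.sum_le_sum fun _ hγ₂ => mul_le_mul_of_nonneg_left
    (hmono (Finset.union_subset_union hAB le_rfl) (Finset.union_subset_union hB (Finset.mem_powerset.1 hγ₂))) (pow_nonneg hq _)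

/-- **THE ONE-SUM FOLD.**  `E₁, E₂` disjoint edge sets whose vertex supports `V₁, V₂` meet in at most one vertex `m`; `M₁ ⊆ E₁`, `M₂ ⊆ E₂`;
`f` does not read `M₂`.  Then `q^{2|V|} · apPsi q (M₁ ∪ M₂) f g = apPsi q M₁ f ĝ` with `ĝ(β) = Σ_{γ₂ ⊆ M₂} q^{k(γ₂)+k(M₂∖γ₂)} g(β ∪ γ₂)`
— by `FK.apExp_series` and the symmetry `γ₂ ↦ M₂ ∖ γ₂` of the weight on the second part. [cite: Grimmett2006, §3.8 (pp. 61–62)] -/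
theorem apPsi_oneSum_eq (q : ℝ) (hd : Disjoint E₁ E₂) (h₁ : ∀ e ∈ (↑E₁ : Set (Sym2 V)), ∀ z ∈ e, z ∈ V₁)
    (h₂ : ∀ e ∈ (↑E₂ : Set (Sym2 V)), ∀ z ∈ e, z ∈ V₂) (hS : V₁ ∩ V₂ ⊆ {m}) {M₁ M₂ : Finset (Sym2 V)} (hM₁ : M₁ ⊆ E₁) (hM₂ : M₂ ⊆ E₂)
    {f : Finset (Sym2 V) → ℝ} (hf : ∀ X Y : Finset (Sym2 V), Y ⊆ M₂ → f (X ∪ Y) = f X) (g : Finset (Sym2 V) → ℝ) :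
    q ^ (2 * Fintype.card V) * apPsi q (M₁ ∪ M₂) f g =
      apPsi q M₁ f (fun β => ∑ γ₂ ∈ M₂.powerset, q ^ apExp M₂ γ₂ * g (β ∪ γ₂)) := by
  have hdM : Disjoint M₁ M₂ := Finset.disjoint_of_subset_left hM₁ (Finset.disjoint_of_subset_right hM₂ hd)
  unfold apPsi
  rw [Finset.mul_sum, sum_powerset_union_disj hdM]
  refine Finset.sum_congr rfl fun γ₁ hγ₁ => ?_
  rw [Finset.mem_powerset] at hγ₁
  have hflip : (∑ γ₂ ∈ M₂.powerset, q ^ apExp M₂ γ₂ * g (M₁ \ γ₁ ∪ γ₂)) =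
      ∑ γ₂ ∈ M₂.powerset, q ^ apExp M₂ γ₂ * g (M₁ \ γ₁ ∪ M₂ \ γ₂) := by
    rw [sum_powerset_flip M₂ (fun γ₂ => q ^ apExp M₂ γ₂ * g (M₁ \ γ₁ ∪ γ₂))]
    exact Finset.sum_congr rfl fun γ₂ hγ₂ => by rw [apExp_compl (Finset.mem_powerset.1 hγ₂)]
  dsimp only
  rw [hflip, ← Finset.sum_sub_distrib, Finset.mul_sum, Finset.mul_sum]
  refine Finset.sum_congr rfl fun γ₂ hγ₂ => ?_
  rw [Finset.mem_powerset] at hγ₂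
  have hexp := apExp_series hd h₁ h₂ hS hM₁ hM₂ hγ₁ hγ₂
  have hpow : q ^ (2 * Fintype.card V) * q ^ apExp (M₁ ∪ M₂) (γ₁ ∪ γ₂) = q ^ apExp M₁ γ₁ * q ^ apExp M₂ γ₂ := by
    rw [← pow_add, ← pow_add, add_comm (2 * Fintype.card V), hexp]
  rw [union_sdiff_union hdM hγ₁ hγ₂, hf γ₁ γ₂ hγ₂, hf (M₁ \ γ₁) (M₂ \ γ₂) Finset.sdiff_subset, ← mul_sub]
  calc q ^ (2 * Fintype.card V) * (q ^ apExp (M₁ ∪ M₂) (γ₁ ∪ γ₂) *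
          ((f γ₁ - f (M₁ \ γ₁)) * (g (γ₁ ∪ γ₂) - g (M₁ \ γ₁ ∪ M₂ \ γ₂))))
      = (q ^ (2 * Fintype.card V) * q ^ apExp (M₁ ∪ M₂) (γ₁ ∪ γ₂)) *
          ((f γ₁ - f (M₁ \ γ₁)) * (g (γ₁ ∪ γ₂) - g (M₁ \ γ₁ ∪ M₂ \ γ₂))) := by ring
    _ = q ^ apExp M₁ γ₁ * ((f γ₁ - f (M₁ \ γ₁)) * (q ^ apExp M₂ γ₂ * (g (γ₁ ∪ γ₂) - g (M₁ \ γ₁ ∪ M₂ \ γ₂)))) := by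
      rw [hpow]; ring

/-- **`C_∞`-TYPE INEQUALITIES PASS TO ONE-SUMS.**  In the setting of `FK.apPsi_oneSum_eq` (`q > 0`): if `apPsi q M₁ f h ≤ 0` for every `h`
monotone on the subsets of `M₁` and not reading the edges of `S`, then `apPsi q (M₁ ∪ M₂) f g ≤ 0` for every `g` monotone on the subsets of
`M₁ ∪ M₂` and not reading `S` — whatever the second part `M₂` is. [cite: Grimmett2006, §3.8 Thm. (3.90) (pp. 61–62)] -/
theorem apPsi_oneSum_nonpos_of {q : ℝ} (hq : 0 < q) (hd : Disjoint E₁ E₂) (h₁ : ∀ e ∈ (↑E₁ : Set (Sym2 V)), ∀ z ∈ e, z ∈ V₁)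
    (h₂ : ∀ e ∈ (↑E₂ : Set (Sym2 V)), ∀ z ∈ e, z ∈ V₂) (hS : V₁ ∩ V₂ ⊆ {m}) {M₁ M₂ : Finset (Sym2 V)} (hM₁ : M₁ ⊆ E₁) (hM₂ : M₂ ⊆ E₂)
    {f : Finset (Sym2 V) → ℝ} (hf : ∀ X Y : Finset (Sym2 V), Y ⊆ M₂ → f (X ∪ Y) = f X) {S : Finset (Sym2 V)}
    (hB : ∀ h : Finset (Sym2 V) → ℝ, (∀ e ∈ S, ∀ A : Finset (Sym2 V), h (insert e A) = h A) →
      (∀ ⦃A B : Finset (Sym2 V)⦄, A ⊆ B → B ⊆ M₁ → h A ≤ h B) → apPsi q M₁ f h ≤ 0)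
    {g : Finset (Sym2 V) → ℝ} (hgS : ∀ e ∈ S, ∀ A : Finset (Sym2 V), g (insert e A) = g A)
    (hmono : ∀ ⦃A B : Finset (Sym2 V)⦄, A ⊆ B → B ⊆ M₁ ∪ M₂ → g A ≤ g B) : apPsi q (M₁ ∪ M₂) f g ≤ 0 := by
  have key := apPsi_oneSum_eq q hd h₁ h₂ hS hM₁ hM₂ hf g
  have hle := hB (fun β => ∑ γ₂ ∈ M₂.powerset, q ^ apExp M₂ γ₂ * g (β ∪ γ₂))
    (fun e he A => oneSumFold_insert q M₂ (hgS e he) A) (fun A B hAB hB' => oneSumFold_mono hq.le hmono hAB hB')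
  rw [← key] at hle
  exact le_of_mul_le_mul_left (by rw [mul_zero]; exact hle) (pow_pos hq _)

/-! ### U¹¹ with the split pair separated by the cut vertex -/

omit [Fintype V] in
/-- The one-edge form against `g'`, folded by the symmetry `γ ↦ M ∖ γ`:
`apPsi q M 1_z g' = 2 Σ_{γ ⊆ M} q^{k(γ)+k(M∖γ)} (1_z(γ) − 1_z(M∖γ)) g'(γ)`. [folklore] -/
theorem apPsi_pivot_eq_two_mul (q : ℝ) (M : Finset (Sym2 V)) (z : Sym2 V) (g' : Finset (Sym2 V) → ℝ) :
    apPsi q M (fun A => if z ∈ A then 1 else 0) g' =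
      2 * ∑ γ ∈ M.powerset, q ^ apExp M γ * (((if z ∈ γ then (1 : ℝ) else 0) - (if z ∈ M \ γ then 1 else 0)) * g' γ) := by
  unfold apPsi
  have hsplit : ∀ γ ∈ M.powerset, q ^ apExp M γ * ((((if z ∈ γ then (1 : ℝ) else 0) - if z ∈ M \ γ then 1 else 0)) *
        (g' γ - g' (M \ γ))) =
      q ^ apExp M γ * ((((if z ∈ γ then (1 : ℝ) else 0) - if z ∈ M \ γ then 1 else 0)) * g' γ) -
        q ^ apExp M γ * ((((if z ∈ γ then (1 : ℝ) else 0) - if z ∈ M \ γ then 1 else 0)) * g' (M \ γ)) := fun γ _ => by ring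
  rw [Finset.sum_congr rfl hsplit, Finset.sum_sub_distrib,
    sum_powerset_flip M (fun γ => q ^ apExp M γ * ((((if z ∈ γ then (1 : ℝ) else 0) - if z ∈ M \ γ then 1 else 0)) * g' (M \ γ))),
    two_mul, sub_eq_add_neg, ← Finset.sum_neg_distrib]
  congr 1
  refine Finset.sum_congr rfl fun γ hγ => ?_
  have hγM := Finset.mem_powerset.1 hγ
  rw [Finset.sdiff_sdiff_eq_self hγM, apExp_compl hγM]
  ring

variable {s t : V}

/-- **U¹¹ WITH THE SPLIT PAIR SEPARATED BY A CUT VERTEX** (`0 < q ≤ 1`).  `M₁ = E ∪ {st} ⊆ E₁` with `E` two-terminal series–parallel between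
`s, t` (`st ∉ E`), `M₂ ⊆ E₂`, the vertex supports of `E₁, E₂` meeting in at most one vertex; pivot `x ∈ M₁`, `y ∈ M₁ ∖ {x}`, `z ∈ M₂`; Theorem U
holds on `M₂` at `z` (hypothesis `hUz` — e.g. `M₂` a 2-connected series–parallel block, `FK.apPsi_pivot_nonpos_of_isTTSP`, or a one-sum of such,
`FK.apPsi_oneSum_nonpos_of`); `g` monotone on the subsets of `M₁ ∪ M₂` not reading `x, z` (it MAY read `y`) ⟹
`apPsi q (M₁ ∪ M₂) 1_x (split_{yz}·g) ≤ 0`.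
Proof: fold (`FK.apPsi_oneSum_eq`); the folded function is `1{y ∈ β} G_out(β) + 1{y ∉ β} G_in(β)`, monotone because `G_in(β) ≤ G_out(β)` is
`FK.apPsi_pivot_eq_two_mul` + `hUz` against `g(β ∪ ·)`; then Theorem U on `M₁` at `x`.
[cite: Grimmett2006, §3.8 Thm. (3.90) (pp. 61–62); §3.9 (pp. 63–64)] -/
theorem apPsi_pivot_split_oneSum_nonpos {q : ℝ} (hq0 : 0 < q) (hq1 : q ≤ 1) (hd : Disjoint E₁ E₂)
    (h₁ : ∀ e ∈ (↑E₁ : Set (Sym2 V)), ∀ z ∈ e, z ∈ V₁) (h₂ : ∀ e ∈ (↑E₂ : Set (Sym2 V)), ∀ z ∈ e, z ∈ V₂) (hS : V₁ ∩ V₂ ⊆ {m})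
    {E : Finset (Sym2 V)} (hE : IsTTSP E s t) (hst : s(s, t) ∉ E) (hM₁ : insert s(s, t) E ⊆ E₁) {M₂ : Finset (Sym2 V)}
    (hM₂ : M₂ ⊆ E₂) {x y z : Sym2 V} (hx : x ∈ insert s(s, t) E) (hy : y ∈ insert s(s, t) E) (hxy : x ≠ y) (hz : z ∈ M₂)
    (hUz : ∀ g' : Finset (Sym2 V) → ℝ, (∀ A : Finset (Sym2 V), g' (insert z A) = g' A) →
      (∀ ⦃A B : Finset (Sym2 V)⦄, A ⊆ B → B ⊆ M₂ → g' A ≤ g' B) → apPsi q M₂ (fun A => if z ∈ A then 1 else 0) g' ≤ 0)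
    {g : Finset (Sym2 V) → ℝ} (hgx : ∀ A : Finset (Sym2 V), g (insert x A) = g A)
    (hgz : ∀ A : Finset (Sym2 V), g (insert z A) = g A)
    (hmono : ∀ ⦃A B : Finset (Sym2 V)⦄, A ⊆ B → B ⊆ insert s(s, t) E ∪ M₂ → g A ≤ g B) :
    apPsi q (insert s(s, t) E ∪ M₂) (fun A => if x ∈ A then 1 else 0) (fun A => splitInd y z A * g A) ≤ 0 := by
  set M₁ := insert s(s, t) E with hM₁def
  have hdM : Disjoint M₁ M₂ := Finset.disjoint_of_subset_left hM₁ (Finset.disjoint_of_subset_right hM₂ hd)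
  have hxM₂ : x ∉ M₂ := fun h => Finset.disjoint_left.1 hdM hx h
  have hyM₂ : y ∉ M₂ := fun h => Finset.disjoint_left.1 hdM hy h
  have hzM₁ : z ∉ M₁ := fun h => Finset.disjoint_left.1 hdM h hz
  have hxz : x ≠ z := fun h => hxM₂ (h ▸ hz)
  have hf : ∀ X Y : Finset (Sym2 V), Y ⊆ M₂ → (fun A : Finset (Sym2 V) => if x ∈ A then (1 : ℝ) else 0) (X ∪ Y) =
      (fun A : Finset (Sym2 V) => if x ∈ A then (1 : ℝ) else 0) X := fun X Y hY => by
    have hxY : x ∉ Y := fun h => hxM₂ (hY h)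
    simp only [Finset.mem_union, hxY, or_false]
  have key := apPsi_oneSum_eq q hd h₁ h₂ hS hM₁ hM₂ (f := fun A => if x ∈ A then (1 : ℝ) else 0) hf
    (fun A => splitInd y z A * g A)
  -- the folded function and its two branches
  set G : Finset (Sym2 V) → ℝ := fun β => ∑ γ₂ ∈ M₂.powerset, q ^ apExp M₂ γ₂ * (splitInd y z (β ∪ γ₂) * g (β ∪ γ₂)) with hGdef
  have Gin : ∀ β : Finset (Sym2 V), β ⊆ M₁ → y ∉ β →
      G β = ∑ γ₂ ∈ M₂.powerset, q ^ apExp M₂ γ₂ * ((if z ∈ γ₂ then (1 : ℝ) else 0) * g (β ∪ γ₂)) := fun β hβ hyβ => by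
    refine Finset.sum_congr rfl fun γ₂ hγ₂ => ?_
    have hyγ : y ∉ γ₂ := fun h => hyM₂ (Finset.mem_powerset.1 hγ₂ h)
    have hzβ : z ∉ β := fun h => hzM₁ (hβ h)
    unfold splitInd
    simp only [Finset.mem_union, hyβ, hyγ, hzβ, or_self, false_or, false_iff, not_not]
  have Gout : ∀ β : Finset (Sym2 V), β ⊆ M₁ → y ∈ β →
      G β = ∑ γ₂ ∈ M₂.powerset, q ^ apExp M₂ γ₂ * ((if z ∈ γ₂ then (0 : ℝ) else 1) * g (β ∪ γ₂)) := fun β hβ hyβ => by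
    refine Finset.sum_congr rfl fun γ₂ hγ₂ => ?_
    have hzβ : z ∉ β := fun h => hzM₁ (hβ h)
    unfold splitInd
    simp only [Finset.mem_union, hyβ, hzβ, true_or, false_or, true_iff, ite_not]
  -- G_in ≤ G_out pointwise: Theorem U on M₂ at z against g(β ∪ ·)
  have inout : ∀ β : Finset (Sym2 V), β ⊆ M₁ →
      (∑ γ₂ ∈ M₂.powerset, q ^ apExp M₂ γ₂ * ((if z ∈ γ₂ then (1 : ℝ) else 0) * g (β ∪ γ₂))) ≤
        ∑ γ₂ ∈ M₂.powerset, q ^ apExp M₂ γ₂ * ((if z ∈ γ₂ then (0 : ℝ) else 1) * g (β ∪ γ₂)) := fun β hβ => by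
    have u := hUz (fun X => g (β ∪ X)) (fun A => by simp only [Finset.union_insert, hgz])
      (fun A B hAB hB => hmono (Finset.union_subset_union le_rfl hAB) (Finset.union_subset_union hβ hB))
    rw [apPsi_pivot_eq_two_mul] at u
    have hdiff : (∑ γ ∈ M₂.powerset, q ^ apExp M₂ γ *
        ((((if z ∈ γ then (1 : ℝ) else 0) - if z ∈ M₂ \ γ then 1 else 0)) * g (β ∪ γ))) =
      (∑ γ₂ ∈ M₂.powerset, q ^ apExp M₂ γ₂ * ((if z ∈ γ₂ then (1 : ℝ) else 0) * g (β ∪ γ₂))) -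
        ∑ γ₂ ∈ M₂.powerset, q ^ apExp M₂ γ₂ * ((if z ∈ γ₂ then (0 : ℝ) else 1) * g (β ∪ γ₂)) := by
      rw [← Finset.sum_sub_distrib]
      refine Finset.sum_congr rfl fun γ _ => ?_
      have hzc : z ∈ M₂ \ γ ↔ z ∉ γ := by rw [Finset.mem_sdiff]; exact ⟨fun h => h.2, fun h => ⟨hz, h⟩⟩
      simp only [hzc]
      by_cases c : z ∈ γ <;> simp only [c, not_true_eq_false, not_false_eq_true, if_true, if_false] <;> ring
    rw [hdiff] at u
    linarith
  -- the folded function is monotone on the subsets of M₁ and does not read x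
  have Gmono : ∀ ⦃A B : Finset (Sym2 V)⦄, A ⊆ B → B ⊆ M₁ → G A ≤ G B := by
    intro A B hAB hB
    have hA : A ⊆ M₁ := hAB.trans hB
    have tin : (∑ γ₂ ∈ M₂.powerset, q ^ apExp M₂ γ₂ * ((if z ∈ γ₂ then (1 : ℝ) else 0) * g (A ∪ γ₂))) ≤
        ∑ γ₂ ∈ M₂.powerset, q ^ apExp M₂ γ₂ * ((if z ∈ γ₂ then (1 : ℝ) else 0) * g (B ∪ γ₂)) :=
      Finset.sum_le_sum fun γ₂ hγ₂ => mul_le_mul_of_nonneg_left (mul_le_mul_of_nonneg_left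
        (hmono (Finset.union_subset_union hAB le_rfl) (Finset.union_subset_union hB (Finset.mem_powerset.1 hγ₂)))
        (by split_ifs <;> norm_num)) (pow_nonneg hq0.le _)
    have tout : (∑ γ₂ ∈ M₂.powerset, q ^ apExp M₂ γ₂ * ((if z ∈ γ₂ then (0 : ℝ) else 1) * g (A ∪ γ₂))) ≤
        ∑ γ₂ ∈ M₂.powerset, q ^ apExp M₂ γ₂ * ((if z ∈ γ₂ then (0 : ℝ) else 1) * g (B ∪ γ₂)) :=
      Finset.sum_le_sum fun γ₂ hγ₂ => mul_le_mul_of_nonneg_left (mul_le_mul_of_nonneg_left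
        (hmono (Finset.union_subset_union hAB le_rfl) (Finset.union_subset_union hB (Finset.mem_powerset.1 hγ₂)))
        (by split_ifs <;> norm_num)) (pow_nonneg hq0.le _)
    by_cases hyA : y ∈ A
    · rw [Gout A hA hyA, Gout B hB (hAB hyA)]; exact tout
    by_cases hyB : y ∈ B
    · rw [Gin A hA hyA, Gout B hB hyB]; exact tin.trans (inout B hB)
    · rw [Gin A hA hyA, Gin B hB hyB]; exact tin
  have Gx : ∀ A : Finset (Sym2 V), G (insert x A) = G A := fun A =>
    Finset.sum_congr rfl fun γ₂ _ => by rw [Finset.insert_union, splitInd_insert_of_ne hxy hxz, hgx]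
  have hle := apPsi_pivot_nonpos_of_isTTSP hq0 hq1 hE hst hx Gx Gmono
  rw [← key] at hle
  exact le_of_mul_le_mul_left (by rw [mul_zero]; exact hle) (pow_pos hq0 _)

/-- **U¹¹ with both marked edges beyond the cut vertex** (`0 < q ≤ 1`): pivot `x ∈ M₁ = E ∪ {st}` (2-connected series–parallel), `y ≠ z ∈ M₂`
(ANY second part meeting the first in at most one vertex), `g` monotone reading none of `x, y, z` ⟹ `apPsi q (M₁ ∪ M₂) 1_x (split_{yz}·g) ≤ 0`:
the fold `Σ_{γ₂} q^{k+k̄} split_{yz}(γ₂) g(β ∪ γ₂)` is monotone outright; Theorem U on `M₁` at `x`.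
[cite: Grimmett2006, §3.8 Thm. (3.90) (pp. 61–62); §3.9 (pp. 63–64)] -/
theorem apPsi_pivot_split_oneSum_nonpos' {q : ℝ} (hq0 : 0 < q) (hq1 : q ≤ 1) (hd : Disjoint E₁ E₂)
    (h₁ : ∀ e ∈ (↑E₁ : Set (Sym2 V)), ∀ z ∈ e, z ∈ V₁) (h₂ : ∀ e ∈ (↑E₂ : Set (Sym2 V)), ∀ z ∈ e, z ∈ V₂) (hS : V₁ ∩ V₂ ⊆ {m})
    {E : Finset (Sym2 V)} (hE : IsTTSP E s t) (hst : s(s, t) ∉ E) (hM₁ : insert s(s, t) E ⊆ E₁) {M₂ : Finset (Sym2 V)}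
    (hM₂ : M₂ ⊆ E₂) {x y z : Sym2 V} (hx : x ∈ insert s(s, t) E) (hy : y ∈ M₂) (hz : z ∈ M₂)
    {g : Finset (Sym2 V) → ℝ} (hgx : ∀ A : Finset (Sym2 V), g (insert x A) = g A)
    (hmono : ∀ ⦃A B : Finset (Sym2 V)⦄, A ⊆ B → B ⊆ insert s(s, t) E ∪ M₂ → g A ≤ g B) :
    apPsi q (insert s(s, t) E ∪ M₂) (fun A => if x ∈ A then 1 else 0) (fun A => splitInd y z A * g A) ≤ 0 := by
  set M₁ := insert s(s, t) E with hM₁def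
  have hdM : Disjoint M₁ M₂ := Finset.disjoint_of_subset_left hM₁ (Finset.disjoint_of_subset_right hM₂ hd)
  have hxM₂ : x ∉ M₂ := fun h => Finset.disjoint_left.1 hdM hx h
  have hyM₁ : y ∉ M₁ := fun h => Finset.disjoint_left.1 hdM h hy
  have hzM₁ : z ∉ M₁ := fun h => Finset.disjoint_left.1 hdM h hz
  have hxy : x ≠ y := fun h => hxM₂ (h ▸ hy)
  have hxz : x ≠ z := fun h => hxM₂ (h ▸ hz)
  have hf : ∀ X Y : Finset (Sym2 V), Y ⊆ M₂ → (fun A : Finset (Sym2 V) => if x ∈ A then (1 : ℝ) else 0) (X ∪ Y) =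
      (fun A : Finset (Sym2 V) => if x ∈ A then (1 : ℝ) else 0) X := fun X Y hY => by
    have hxY : x ∉ Y := fun h => hxM₂ (hY h)
    simp only [Finset.mem_union, hxY, or_false]
  have key := apPsi_oneSum_eq q hd h₁ h₂ hS hM₁ hM₂ (f := fun A => if x ∈ A then (1 : ℝ) else 0) hf
    (fun A => splitInd y z A * g A)
  have Gsplit : ∀ β : Finset (Sym2 V), β ⊆ M₁ → ∀ γ₂ : Finset (Sym2 V), splitInd y z (β ∪ γ₂) = splitInd y z γ₂ :=
    fun β hβ γ₂ => by
      have hyβ : y ∉ β := fun h => hyM₁ (hβ h)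
      have hzβ : z ∉ β := fun h => hzM₁ (hβ h)
      unfold splitInd
      simp only [Finset.mem_union, hyβ, hzβ, false_or]
  have Gmono : ∀ ⦃A B : Finset (Sym2 V)⦄, A ⊆ B → B ⊆ M₁ →
      (∑ γ₂ ∈ M₂.powerset, q ^ apExp M₂ γ₂ * (splitInd y z (A ∪ γ₂) * g (A ∪ γ₂))) ≤
        ∑ γ₂ ∈ M₂.powerset, q ^ apExp M₂ γ₂ * (splitInd y z (B ∪ γ₂) * g (B ∪ γ₂)) := by
    intro A B hAB hB
    refine Finset.sum_le_sum fun γ₂ hγ₂ => ?_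
    rw [Gsplit A (hAB.trans hB), Gsplit B hB]
    refine mul_le_mul_of_nonneg_left (mul_le_mul_of_nonneg_left
      (hmono (Finset.union_subset_union hAB le_rfl) (Finset.union_subset_union hB (Finset.mem_powerset.1 hγ₂))) ?_)
      (pow_nonneg hq0.le _)
    unfold splitInd; split_ifs <;> norm_num
  have Gx : ∀ A : Finset (Sym2 V), (∑ γ₂ ∈ M₂.powerset, q ^ apExp M₂ γ₂ * (splitInd y z (insert x A ∪ γ₂) * g (insert x A ∪ γ₂))) =
      ∑ γ₂ ∈ M₂.powerset, q ^ apExp M₂ γ₂ * (splitInd y z (A ∪ γ₂) * g (A ∪ γ₂)) := fun A =>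
    Finset.sum_congr rfl fun γ₂ _ => by rw [Finset.insert_union, splitInd_insert_of_ne hxy hxz, hgx]
  have hle := apPsi_pivot_nonpos_of_isTTSP hq0 hq1 hE hst hx Gx Gmono
  rw [← key] at hle
  exact le_of_mul_le_mul_left (by rw [mul_zero]; exact hle) (pow_pos hq0 _)

end OneSum

end FK

end Summit.CriticalPhenomena.PercolationContinuityZ3.Theorems

end
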